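import Literature.NumberTheory.GaloisRepresentations.LubinTateUnramifiedDisjointLattice
import Literature.NumberTheory.GaloisRepresentations.LubinTateComparisonUnramified
import HarnessLib

/-!
# `𝒪_{E·K_π^{m+1}} = 𝒪_E[λ_{m+1}]` for an unramified base `E`: every unit of `E·K_π^{m+1}` is the value at `λ_{m+1}`
# of a power series over `𝒪_E` with unit constant term (de Shalit I §1.8, §2.2; Serre, *Local Fields* I §6)

De Shalit, *Iwasawa theory of elliptic curves with complex multiplication* (1987), Ch. I §1.8: over an unramified base
`k' = E` the division field `k'(W_f^{m+1}) = E·K_π^{m+1}` is TOTALLY RAMIFIED over `E` and any primitive division point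
is a prime element; §2.2 (proof of the Theorem) uses the consequence "there exists `h ∈ R^×` with `h(ω_m) = β_m`".
This file proves that consequence for `E ⊆ F^{nr} = maxUnramified F` finite over `F`, `f = πX + X^q` the Lubin–Tate
series of `F`, `λ = λ_{m+1}` (`ltRoot π m`), by the coordinate argument of `LubinTateNormGroup.exists_series_of_norm_eq_one`
run over the base `E` instead of `F`:

* `spectralNorm_adjoin_eq_algNorm` — for `L = E(λ) ⊆ F̄`, Mathlib's `spectralNorm E L` is the absolute value `algNorm F` of
  `F̄` (uniqueness of the extension of the complete norm of `E`, `spectralNorm_unique_field_norm_ext`);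
* `exists_norm_eq_zpow_of_le_maxUnramified` — the value group of `E ⊆ F^{nr}` is `‖π‖^ℤ` (tree
  `exists_algNorm_eq_zpow_of_mem_maxUnramified`);
* `natDegree_minpoly_ltRoot_of_le_maxUnramified` — `deg minpoly_E(λ) = (q−1)q^m`;
* ★ `exists_coords_of_norm_eq_one` — **every `y ∈ E·K_π^{m+1}` with `‖y‖ = 1` is `Σ_{i<(q−1)q^m} c_i λ^i` with `c_i ∈ 𝒪_E`
  and `‖c_0‖ = 1`** (all coordinates in the power basis `λ^i` of `E(λ)/E` are integral and the constant one is dominant: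
  `‖λ‖^{(q−1)q^m} = ‖π‖`, `‖E^×‖ = ‖π‖^ℤ`, tree `norm_repr_mul_pow_le` / `exists_dominant_term`);
* ★★ `exists_isUnit_evS_inclPt_genPt_eq` — **every unit `y` of `E·K_π^{m+1}` is `h^ι(λ')`, the value at `λ' = ι λ_{m+1}` of
  some `h ∈ 𝒪_E⟦X⟧` (a polynomial) with unit constant term**, `ι : 𝒪_E⟦X⟧ → 𝒪_{E·K_π^{m+1}}⟦X⟧`.

## References

* E. de Shalit, *Iwasawa theory of elliptic curves with complex multiplication* (1987), Ch. I §1.8, §2.2 (proof). [deShalit1987]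
* J.-P. Serre, *Local Fields* (1979), Ch. I §6 Prop. 17–18; Ch. II §2 Cor. 3. [SerreLocalFields1979]

## Mathlib / tree reuse

`spectralNorm_unique_field_norm_ext`, `IntermediateField.adjoin.powerBasis(_dim,_gen)`, `PowerBasis.basis.sum_repr`,
`IntermediateField.restrictScalars_adjoin_eq_sup`, `MvPowerSeries.aeval_coe`; tree: `norm_repr_mul_pow_le`,
`norm_le_one_of_norm_mul_pow_le`, `exists_dominant_term`, `eq_of_norm_mul_pow_eq`, `algNorm_ltRoot_pow`,
`algNorm_eq_of_mem_rootSet_minpoly`, `minpoly_ltRoot_eq_map_minpoly`, `exists_algNorm_eq_zpow_of_mem_maxUnramified`,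
`norm_coe_eq_algNorm`.
-/

noncomputable section

namespace Literature.NumberTheory.GaloisRepresentations

namespace LubinTate

section EvSCoe

variable {S : Type*} [CommRing S] [UniformSpace S] [IsUniformAddGroup S] [IsTopologicalRing S]
  [IsLinearTopology S S] [T2Space S] [CompleteSpace S]
variable (M : NilIdeal S)

/-- **`evS` on polynomials is `Polynomial.aeval`**: `p(y)` for `p ∈ S[X] ⊆ S⟦X⟧`. [cite: CasselsFrohlichANT1967, Ch. VI §3.2] -/
theorem evS_coe (y : M.toIdeal) (p : Polynomial S) : evS M y (p : PowerSeries S) = Polynomial.aeval (y : S) p := by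
  rw [evS, PowerSeries.aeval_coe]

end EvSCoe

end LubinTate

section UnramifiedRelativeUnits

open GaloisRepresentations.IsNonarchimedeanLocalField LubinTate ValuativeRel Field Polynomial

-- `F : Type` (universe 0) to match `LubinTateUnramifiedDisjointLattice` (`algNorm_ltRoot_pow`).
variable (F : Type) [Field F] [ValuativeRel F] [TopologicalSpace F] [IsNonarchimedeanLocalField F]

attribute [local instance] ltNormUniformSpace ltNormIsUniformAddGroup rk1 nF nE fintypeResidueField

variable {F}
variable {π : 𝒪[F]} (hπ : (valuation F).IsUniformizer (π : F))
variable (E : IntermediateField F (AlgebraicClosure F)) [FiniteDimensional F E]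

/-! ### The spectral norm over the base `E` is the absolute value of `F̄` -/

omit [FiniteDimensional F E] in
/-- The absolute value `algNorm F` of `F̄` restricted to an intermediate field `L` of `F̄/E`, as an absolute value on `L`.
[cite: SerreLocalFields1979, Ch. II §2 Cor. 3] -/
def algNormAbsValue (L : IntermediateField E (AlgebraicClosure F)) : AbsoluteValue L ℝ where
  toFun x := algNorm F (x : AlgebraicClosure F)
  map_mul' x y := by
    rw [MulMemClass.coe_mul, algNorm_mul]
  nonneg' x := algNorm_nonneg _
  eq_zero' x := by
    change algNorm F (x : AlgebraicClosure F) = 0 ↔ x = 0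
    rw [algNorm_eq_zero_iff, ZeroMemClass.coe_eq_zero]
  add_le' x y := by
    change algNorm F (((x + y : L) : AlgebraicClosure F)) ≤ algNorm F (x : AlgebraicClosure F) + algNorm F (y : AlgebraicClosure F)
    rw [AddMemClass.coe_add]
    exact (algNorm_add_le _ _).trans (max_le_add_of_nonneg (algNorm_nonneg _) (algNorm_nonneg _))

omit [FiniteDimensional F E] in
/-- Unfolding. [cite: SerreLocalFields1979, Ch. II §2 Cor. 3] -/
theorem algNormAbsValue_apply (L : IntermediateField E (AlgebraicClosure F)) (x : L) :
    algNormAbsValue E L x = algNorm F (x : AlgebraicClosure F) := rfl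

/-- ★ **`spectralNorm E L = algNorm F` on an intermediate field `L` of `F̄/E` algebraic over `E`** (`E` is complete, and
the absolute value of `F̄` extends the norm of `E`: uniqueness `spectralNorm_unique_field_norm_ext`).
[cite: SerreLocalFields1979, Ch. II §2 Cor. 3] -/
theorem spectralNorm_intermediateField_eq_algNorm (L : IntermediateField E (AlgebraicClosure F))
    [Algebra.IsAlgebraic E L] (x : L) : spectralNorm E L x = algNorm F (x : AlgebraicClosure F) := by
  rw [← algNormAbsValue_apply E L x]
  refine (spectralNorm_unique_field_norm_ext (K := E) (L := L) (f := algNormAbsValue E L) (fun c => ?_) x).symm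
  rw [algNormAbsValue_apply, norm_coe_eq_algNorm]
  rfl

/-! ### The value group of `E ⊆ F^{nr}` and the degree of `λ_{m+1}` over `E` -/

/-- The image of `π` in `E ⊆ F̄` is the image of `π` in `F̄` (unfolding). [cite: SerreLocalFields1979, Ch. II §2 Cor. 3] -/
theorem coe_coe_algebraMap_pi (a : 𝒪[F]) :
    (((algebraMap 𝒪[F] (unitBall E) a : unitBall E) : E) : AlgebraicClosure F) = algebraMap 𝒪[F] (AlgebraicClosure F) a := by
  rw [algebraMap_integer_apply, IsScalarTower.algebraMap_apply 𝒪[F] F (AlgebraicClosure F)]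
  rfl

include hπ in
/-- **The value group of `E ⊆ F^{nr}` is `‖π‖^ℤ`**: `‖x‖ = ‖π‖^k` for every `x ≠ 0` in `E`.
[cite: SerreLocalFields1979, Ch. IV §4 Cor. 2 to Prop. 16] -/
theorem exists_norm_eq_zpow_of_le_maxUnramified (hE : E ≤ maxUnramified F) (x : E) (hx : x ≠ 0) :
    ∃ k : ℤ, ‖x‖ = ‖((algebraMap 𝒪[F] (unitBall E) π : unitBall E) : E)‖ ^ k := by
  have hx0 : (x : AlgebraicClosure F) ≠ 0 := fun h0 => hx (by exact_mod_cast h0)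
  obtain ⟨k, hk⟩ := exists_algNorm_eq_zpow_of_mem_maxUnramified (irreducible_of_isUniformizer' hπ) (hE x.2) hx0
  refine ⟨k, ?_⟩
  rw [norm_coe_eq_algNorm, norm_coe_eq_algNorm, coe_coe_algebraMap_pi, hk]

include hπ in
/-- **`deg minpoly_E(λ_{m+1}) = (q−1)q^m`** for `E ⊆ F^{nr}`. [cite: deShalit1987, Ch. I §1.8] -/
theorem natDegree_minpoly_ltRoot_of_le_maxUnramified (hE : E ≤ maxUnramified F) (m : ℕ) :
    (minpoly E (ltRoot π m)).natDegree = (residueFieldCard F - 1) * residueFieldCard F ^ m := by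
  rw [minpoly_ltRoot_eq_map_minpoly hπ E hE m, Polynomial.natDegree_map, minpoly_ltRoot π hπ m,
    (monic_ltPolyDiv π m).1.natDegree_map, (monic_ltPolyDiv π m).2.1]

/-! ### Integral coordinates in the power basis `λ^i` of `E(λ)/E` -/

include hπ in
/-- ★ **Integral coordinates**: for `E ⊆ F^{nr}` finite over `F` and `y ∈ E·K_π^{m+1}` with `‖y‖ = 1` there are
`c_0, …, c_{d-1} ∈ 𝒪_E` (`d = (q−1)q^m`), `‖c_0‖ = 1`, with `y = Σ_i c_i λ_{m+1}^i` — `E·K_π^{m+1} = E(λ_{m+1})` is totally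
ramified over `E` with prime `λ_{m+1}` (all coordinates are integral, the constant one is dominant).
[cite: SerreLocalFields1979, Ch. I §6 Prop. 17–18] -/
theorem exists_coords_of_norm_eq_one (hE : E ≤ maxUnramified F) (m : ℕ)
    (y : (E ⊔ ltField π m : IntermediateField F (AlgebraicClosure F))) (hy : ‖y‖ = 1) :
    ∃ (d : ℕ) (hd : 0 < d) (c : Fin d → unitBall E), ‖((c ⟨0, hd⟩ : unitBall E) : E)‖ = 1 ∧
      (y : AlgebraicClosure F) = ∑ i : Fin d, (((c i : unitBall E) : E) : AlgebraicClosure F) * ltRoot π m ^ (i : ℕ) := by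
  classical
  have hq : 1 < residueFieldCard F := one_lt_residueFieldCard F
  have hint : IsIntegral E (ltRoot π m) := (isIntegral_ltRoot π m).tower_top
  set L : IntermediateField E (AlgebraicClosure F) := IntermediateField.adjoin E {ltRoot π m} with hL
  haveI : FiniteDimensional E L := IntermediateField.adjoin.finiteDimensional hint
  set pb : PowerBasis E L := IntermediateField.adjoin.powerBasis hint with hpb
  have hpbgen : (pb.gen : AlgebraicClosure F) = ltRoot π m := by
    rw [hpb, IntermediateField.adjoin.powerBasis_gen]; rfl
  have hpbdim : pb.dim = (residueFieldCard F - 1) * residueFieldCard F ^ m := by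
    rw [hpb, IntermediateField.adjoin.powerBasis_dim, natDegree_minpoly_ltRoot_of_le_maxUnramified hπ E hE m]
  have hdpos : 0 < pb.dim := by rw [hpbdim]; exact Nat.mul_pos (by omega) (pow_pos (by omega) _)
  -- spectral data over the base `E`
  set ϖ : E := ((algebraMap 𝒪[F] (unitBall E) π : unitBall E) : E) with hϖ
  have hϖn0 : 0 < ‖ϖ‖ := norm_algebraMap_pi_pos hπ E
  have hϖn1 : ‖ϖ‖ < 1 := norm_algebraMap_pi_lt_one hπ E
  have hval : ∀ x : E, x ≠ 0 → ∃ k : ℤ, ‖x‖ = ‖ϖ‖ ^ k := exists_norm_eq_zpow_of_le_maxUnramified hπ E hE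
  have hsp : ∀ z : L, spectralNorm E L z = algNorm F (z : AlgebraicClosure F) :=
    spectralNorm_intermediateField_eq_algNorm E L
  have hα : spectralNorm E L pb.gen ^ pb.dim = ‖ϖ‖ := by
    rw [hsp, hpbgen, hpbdim, algNorm_ltRoot_pow hπ m, hϖ, norm_coe_eq_algNorm, coe_coe_algebraMap_pi]
  have ht : 0 < spectralNorm E L pb.gen := by
    rcases (spectralNorm_nonneg (K := E) pb.gen).eq_or_lt with h | h
    · exfalso
      rw [← h, zero_pow hdpos.ne'] at hα
      exact hϖn0.ne hα
    · exact h
  -- `y` as an element of `L = E(λ) ⊇ E·K_π^{m+1}`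
  have hyL : (y : AlgebraicClosure F) ∈ L := by
    have h1 : (y : AlgebraicClosure F) ∈ IntermediateField.restrictScalars F L := by
      rw [hL, IntermediateField.restrictScalars_adjoin_eq_sup]; exact y.2
    exact (IntermediateField.mem_restrictScalars F).mp h1
  set y' : L := ⟨(y : AlgebraicClosure F), hyL⟩ with hy'
  have hy'1 : spectralNorm E L y' = 1 := by rw [hsp, hy', ← norm_coe_eq_algNorm, hy]
  set c := pb.basis.repr y' with hc
  -- all coordinates are integral
  have hc1 : ∀ i, ‖c i‖ ≤ 1 := fun i =>
    norm_le_one_of_norm_mul_pow_le hϖn0 hϖn1 hval ht hα i.2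
      ((norm_repr_mul_pow_le hϖn0 hϖn1 hval pb hα y' i).trans hy'1.le)
  -- the constant coordinate is a unit
  have hc0 : ‖c ⟨0, hdpos⟩‖ = 1 := by
    have hy0 : y' ≠ 0 := by
      intro h0
      rw [h0, spectralNorm_zero] at hy'1
      exact zero_ne_one hy'1
    obtain ⟨i₀, hci₀, hnorm, -⟩ := exists_dominant_term E L hϖn0 hϖn1 hval pb hα hy0
    have hi₀ : (i₀ : ℕ) = 0 :=
      eq_of_norm_mul_pow_eq hϖn0 hϖn1 hval ht hα hci₀ one_ne_zero i₀.2 hdpos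
        (by rw [norm_one, pow_zero, one_mul, ← hnorm, hy'1])
    have hi₀' : i₀ = ⟨0, hdpos⟩ := Fin.ext hi₀
    rw [← hi₀']
    have := hnorm
    rw [hi₀, pow_zero, mul_one, hy'1] at this
    exact this.symm
  refine ⟨pb.dim, hdpos, fun i => ⟨c i, (mem_unitBall_iff E).mpr (hc1 i)⟩, hc0, ?_⟩
  -- `y = Σ c_i λ^i`
  have e := congrArg (fun z : L => (z : AlgebraicClosure F)) (pb.basis.sum_repr y').symm
  rw [hy'] at e
  change (y : AlgebraicClosure F) = _ at e
  rw [e]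
  change ((∑ i, pb.basis.repr y' i • pb.basis i : L) : AlgebraicClosure F) = _
  rw [AddSubmonoidClass.coe_finsetSum]
  refine Finset.sum_congr rfl fun i _ => ?_
  rw [PowerBasis.coe_basis, IntermediateField.coe_smul, SubmonoidClass.coe_pow, hpbgen, Algebra.smul_def]
  rfl

/-! ### Unit series through `λ' = ι λ_{m+1}` -/

include hπ in
/-- ★★ **Every unit of `E·K_π^{m+1}` is `h^ι(λ')` for some `h ∈ 𝒪_E⟦X⟧` with unit constant term** (`E ⊆ F^{nr}` finite over
`F`; `λ' = ι(λ_{m+1})`, `h^ι` the image of `h` in `𝒪_{E·K_π^{m+1}}⟦X⟧`, evaluated with `evS`): the input "choose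
`h ∈ R^×` with `h(ω_m) = β_m`" of de Shalit's interpolation theorem over an unramified base.
[cite: deShalit1987, Ch. I §2.2 Theorem (proof); SerreLocalFields1979, Ch. I §6 Prop. 18] -/
theorem exists_isUnit_evS_inclPt_genPt_eq (hE : E ≤ maxUnramified F) (m : ℕ)
    (y : (E ⊔ ltField π m : IntermediateField F (AlgebraicClosure F))) (hy : ‖y‖ = 1) :
    ∃ h : PowerSeries (unitBall E), IsUnit (PowerSeries.constantCoeff h) ∧
      ((evS (maxNilIdeal F (E ⊔ ltField π m : IntermediateField F (AlgebraicClosure F)))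
          (inclPt (le_sup_right : ltField π m ≤ E ⊔ ltField π m) (genPt hπ m))
          (PowerSeries.map (inclUnitBall (F := F) (le_sup_left : E ≤ E ⊔ ltField π m) :
            unitBall E →+* unitBall (E ⊔ ltField π m : IntermediateField F (AlgebraicClosure F))) h) :
          unitBall (E ⊔ ltField π m : IntermediateField F (AlgebraicClosure F))) :
          (E ⊔ ltField π m : IntermediateField F (AlgebraicClosure F))) = y := by
  classical
  obtain ⟨d, hd, c, hc0, hyc⟩ := exists_coords_of_norm_eq_one hπ E hE m y hy
  set p : (unitBall E)[X] := ∑ i : Fin d, Polynomial.C (c i) * Polynomial.X ^ (i : ℕ) with hp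
  refine ⟨(p : PowerSeries (unitBall E)), ?_, ?_⟩
  · -- constant coefficient `c 0`, a unit
    rw [← PowerSeries.coeff_zero_eq_constantCoeff_apply, Polynomial.coeff_coe]
    have hp0 : p.coeff 0 = c ⟨0, hd⟩ := by
      rw [hp, Polynomial.finsetSum_coeff]
      simp only [Polynomial.coeff_C_mul_X_pow]
      rw [Finset.sum_eq_single ⟨0, hd⟩ (fun i _ hi => if_neg fun h0 => hi (Fin.ext h0.symm))
        (fun h => absurd (Finset.mem_univ _) h), if_pos rfl]
    rw [hp0, Valuation.Integers.isUnit_iff_valuation_eq_one (Valuation.integer.integers (NormedField.valuation (K := E)))]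
    apply Subtype.ext
    change ‖((c ⟨0, hd⟩ : unitBall E) : E)‖ = (1 : ℝ)
    exact hc0
  · -- the value at `λ'` is `y`
    refine Subtype.ext ?_
    rw [← Polynomial.polynomial_map_coe, evS_coe, hyc, hp, Polynomial.map_sum, map_sum, AddSubmonoidClass.coe_finsetSum,
      AddSubmonoidClass.coe_finsetSum]
    refine Finset.sum_congr rfl fun i _ => ?_
    rw [Polynomial.map_mul, Polynomial.map_pow, Polynomial.map_C, Polynomial.map_X, map_mul, map_pow,
      Polynomial.aeval_C, Polynomial.aeval_X, Subring.coe_mul, SubmonoidClass.coe_pow, MulMemClass.coe_mul,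
      SubmonoidClass.coe_pow, coe_inclPt]
    rfl

end UnramifiedRelativeUnits

end Literature.NumberTheory.GaloisRepresentations
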